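import Literature.NumberTheory.Transcendental.KZDilationLiouvilleRelations
import Literature.NumberTheory.Transcendental.KZDilationLiouvillePrep
import Literature.NumberTheory.Transcendental.KZDilationLiouvilleLifts
import Literature.NumberTheory.Transcendental.KZDilationLiouvilleSectorKernel
import HarnessLib

/-!
# The Liouville sector of the dilation pencil, IV: the lift

**Theorem** (`KZ.dilationLiouvilleSector_lift`, unconditional). Let `N` be Nash on `(a,b) ⊇ [0,1]`,
let `w_k = u_k + iv_k` (`k < A`) be Nash LOOPS on `(a,b)` in the slit plane (`u_k, v_k` Nash real,
`0 < u_k ∨ v_k ≠ 0`), and `c_k = γ_k + iδ_k` algebraic. The real one-variable integrand in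
LIOUVILLE NORMAL FORM
  `g = N' + Σ_k Re(c_k w_k'/w_k) = N' + Σ_k [γ_k (u_k'u_k + v_k'v_k) − δ_k (v_k'u_k − u_k'v_k)]/(u_k² + v_k²)`
— by Liouville's theorem the shape of every algebraic integrand with an ELEMENTARY antiderivative
`∫ g = N + Σ c_k log w_k`, in particular every genus-0 datum, and every `P/Q ∈ ℚ(x)` (affine `w_k`)
— with vanishing cube period `∫₀¹ g = 0` has its dilation function `v_g(ϖ) = ∫_{[0,1]¹} g(ϖz) dz`
in `(ϖ − 1)·D'` with ONE Nash kernel near `[0,1] × [0,1]`: the conclusion of the glue stub / of the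
crux `DilationLiftAtOne` (route `KontsevichZagierPeriods/LiftingCriteria`) for this `g`.
Proof: `∫₀¹ g = (N(1) − N(0)) + Σ_k Re(c_k (Log w_k(1) − Log w_k(0)))` (principal logarithm along a
loop in the slit plane); Baker's theorem on these DIFFERENCES of logarithms
(`liouville_decomposition`, file I) kills `N(1) − N(0)` and decomposes the logarithmic-derivative
part along exact relations into modulus parts (normalised moduli `M_k = |w_k|²/|w_k(0)|²`,
`exists_kernel_logPart'`) and argument parts (`exists_kernel_argPart'`, Möbius-normalised angle
halving); the exact part is `(ϖ − 1)·dslope (dslope N 0) 1`; sum the kernels.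

Everything is proved; no `def`, no named fact.

## References
* A. Baker, *Transcendental Number Theory* (1975), Thm. 2.1. [`Baker1975`]
* M. Kontsevich, D. Zagier, *Periods* (2001), §1.2. [`KontsevichZagier2001`]
-/

noncomputable section

open Set MeasureTheory Filter MvPolynomial Complex
open scoped BigOperators Topology Real
open Literature.ModelTheory.ExponentialFields

namespace Literature.NumberTheory.Transcendental

namespace KZ

open BakerSectorComplex DilationLogSector LiouvilleSector

/-- **The Liouville sector of the glue holds unconditionally.** See the module docstring.
[cite: Baker1975, Theorem 2.1] -/
theorem dilationLiouvilleSector_lift {a b : ℝ} (ha : a < 0) (hb : 1 < b) {N : ℝ → ℝ}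
    (hNs : IsSemialgebraicFunOn ℚ {t : Fin 1 → ℝ | t 0 ∈ Ioo a b} (fun t => N (t 0)))
    (hNa : ∀ x ∈ Ioo a b, AnalyticAt ℝ N x)
    {A : ℕ} {u v : Fin A → ℝ → ℝ}
    (hus : ∀ k, IsSemialgebraicFunOn ℚ {t : Fin 1 → ℝ | t 0 ∈ Ioo a b} (fun t => u k (t 0)))
    (hvs : ∀ k, IsSemialgebraicFunOn ℚ {t : Fin 1 → ℝ | t 0 ∈ Ioo a b} (fun t => v k (t 0)))
    (hua : ∀ k, ∀ x ∈ Ioo a b, AnalyticAt ℝ (u k) x) (hva : ∀ k, ∀ x ∈ Ioo a b, AnalyticAt ℝ (v k) x)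
    (hslit : ∀ k, ∀ x ∈ Ioo a b, 0 < u k x ∨ v k x ≠ 0)
    {γ δ : Fin A → ℝ} (hγ : ∀ k, IsAlgebraic ℚ (γ k)) (hδ : ∀ k, IsAlgebraic ℚ (δ k))
    (hsum : (∫ z in Set.pi Set.univ (fun _ : Fin 1 => Icc (0:ℝ) 1),
      (deriv N (((1:ℝ) • z) 0) + ∑ k,
        (γ k * ((deriv (u k) (((1:ℝ) • z) 0) * u k (((1:ℝ) • z) 0) +
            deriv (v k) (((1:ℝ) • z) 0) * v k (((1:ℝ) • z) 0)) /
            (u k (((1:ℝ) • z) 0) ^ 2 + v k (((1:ℝ) • z) 0) ^ 2)) -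
          δ k * ((deriv (v k) (((1:ℝ) • z) 0) * u k (((1:ℝ) • z) 0) -
            deriv (u k) (((1:ℝ) • z) 0) * v k (((1:ℝ) • z) 0)) /
            (u k (((1:ℝ) • z) 0) ^ 2 + v k (((1:ℝ) • z) 0) ^ 2))))) = 0) :
    ∃ (K : (Fin 2 → ℝ) → ℝ) (V : Set (Fin 2 → ℝ)), IsOpen V ∧
      (∀ ϖ ∈ Icc (0:ℝ) 1, ∀ x ∈ Set.pi Set.univ (fun _ : Fin 1 => Icc (0:ℝ) 1),
        Matrix.vecCons ϖ x ∈ V) ∧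
      IsSemialgebraicFunOn ℚ V K ∧ AnalyticOnNhd ℝ K V ∧
      ∀ ϖ ∈ Icc (0:ℝ) 1,
        (∫ z in Set.pi Set.univ (fun _ : Fin 1 => Icc (0:ℝ) 1),
          (deriv N ((ϖ • z) 0) + ∑ k,
            (γ k * ((deriv (u k) ((ϖ • z) 0) * u k ((ϖ • z) 0) +
                deriv (v k) ((ϖ • z) 0) * v k ((ϖ • z) 0)) /
                (u k ((ϖ • z) 0) ^ 2 + v k ((ϖ • z) 0) ^ 2)) -
              δ k * ((deriv (v k) ((ϖ • z) 0) * u k ((ϖ • z) 0) -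
                deriv (u k) ((ϖ • z) 0) * v k ((ϖ • z) 0)) /
                (u k ((ϖ • z) 0) ^ 2 + v k ((ϖ • z) 0) ^ 2))))) =
          (ϖ - 1) * ∫ y in Set.pi Set.univ (fun _ : Fin 1 => Icc (0:ℝ) 1),
            K (Matrix.vecCons ϖ (ϖ • y)) := by
  classical
  have hb0 : (0:ℝ) < b := zero_lt_one.trans hb
  have h0I : (0:ℝ) ∈ Ioo a b := ⟨ha, hb0⟩
  have h1I : (1:ℝ) ∈ Ioo a b := ⟨ha.trans zero_lt_one, hb⟩
  have hsub : Icc (0:ℝ) 1 ⊆ Ioo a b := fun x hx => ⟨ha.trans_le hx.1, hx.2.trans_lt hb⟩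
  have hI : IsSemialgebraic ℚ {t : Fin 1 → ℝ | t 0 ∈ Ioo a b} :=
    IsSemialgebraicFunOn.isSemialgebraic_holds hNs
  have hdil : ∀ {ϖ : ℝ}, ϖ ∈ Icc (0:ℝ) 1 → ∀ z ∈ Set.pi Set.univ (fun _ : Fin 1 => Icc (0:ℝ) 1),
      (ϖ • z) 0 ∈ Ioo a b := by
    intro ϖ hϖ z hz
    have hz0 : z 0 ∈ Icc (0:ℝ) 1 := (Set.mem_univ_pi.mp hz) 0
    refine hsub ⟨?_, ?_⟩
    · simpa using mul_nonneg hϖ.1 hz0.1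
    · simpa using mul_le_one₀ hϖ.2 hz0.1 hz0.2
  -- the exact part `N`
  have hNd : ∀ x ∈ Ioo a b, HasDerivAt N (deriv N x) x := fun x hx =>
    (hNa x hx).differentiableAt.hasDerivAt
  have hN'c : ContinuousOn (deriv N) (Ioo a b) := fun x hx =>
    (hNa x hx).deriv.continuousAt.continuousWithinAt
  -- derivatives and continuity of the loops
  have hud : ∀ k, ∀ x ∈ Ioo a b, HasDerivAt (u k) (deriv (u k) x) x := fun k x hx =>
    (hua k x hx).differentiableAt.hasDerivAt
  have hvd : ∀ k, ∀ x ∈ Ioo a b, HasDerivAt (v k) (deriv (v k) x) x := fun k x hx =>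
    (hva k x hx).differentiableAt.hasDerivAt
  have huc : ∀ k, ContinuousOn (u k) (Ioo a b) := fun k x hx =>
    (hua k x hx).continuousAt.continuousWithinAt
  have hvc : ∀ k, ContinuousOn (v k) (Ioo a b) := fun k x hx =>
    (hva k x hx).continuousAt.continuousWithinAt
  have hu'c : ∀ k, ContinuousOn (deriv (u k)) (Ioo a b) := fun k x hx =>
    (hua k x hx).deriv.continuousAt.continuousWithinAt
  have hv'c : ∀ k, ContinuousOn (deriv (v k)) (Ioo a b) := fun k x hx =>
    (hva k x hx).deriv.continuousAt.continuousWithinAt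
  have hm0 : ∀ k, ∀ x ∈ Ioo a b, u k x ^ 2 + v k x ^ 2 ≠ 0 := fun k x hx => (modSq_pos (hslit k x hx)).ne'
  -- the real and imaginary logarithmic derivatives
  set RL : Fin A → ℝ → ℝ := fun k x =>
    (deriv (u k) x * u k x + deriv (v k) x * v k x) / (u k x ^ 2 + v k x ^ 2) with hRL
  set IL : Fin A → ℝ → ℝ := fun k x =>
    (deriv (v k) x * u k x - deriv (u k) x * v k x) / (u k x ^ 2 + v k x ^ 2) with hIL
  have hRLc : ∀ k, ContinuousOn (RL k) (Ioo a b) := fun k =>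
    (((hu'c k).mul (huc k)).add ((hv'c k).mul (hvc k))).div
      (((huc k).pow 2).add ((hvc k).pow 2)) (hm0 k)
  have hILc : ∀ k, ContinuousOn (IL k) (Ioo a b) := fun k =>
    (((hv'c k).mul (huc k)).sub ((hu'c k).mul (hvc k))).div
      (((huc k).pow 2).add ((hvc k).pow 2)) (hm0 k)
  -- the logarithmic-derivative part `σ` and its primitive `Λ = Re Σ_k c_k Log w_k`
  set σ : ℝ → ℝ := fun x => ∑ k, (γ k * RL k x - δ k * IL k x) with hσ_def
  set W : Fin A → ℝ → ℂ := fun k x => (u k x : ℂ) + (v k x : ℂ) * I with hW_def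
  set Λ : ℝ → ℝ := fun x => (∑ k, ((γ k : ℂ) + (δ k : ℂ) * I) * Complex.log (W k x)).re with hΛ_def
  have hΛd : ∀ x ∈ Ioo a b, HasDerivAt Λ (σ x) x := by
    intro x hx
    have h1 := HasDerivAt.fun_sum (u := Finset.univ) fun k _ =>
      (hasDerivAt_log_loop (hud k x hx) (hvd k x hx) (hslit k x hx)).const_mul
        ((γ k : ℂ) + (δ k : ℂ) * I)
    have h2 := Complex.reCLM.hasFDerivAt.comp_hasDerivAt x h1
    have hσx : σ x = Complex.reCLM (∑ k, ((γ k : ℂ) + (δ k : ℂ) * I) *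
        ((((deriv (u k) x : ℝ) : ℂ) + ((deriv (v k) x : ℝ) : ℂ) * I) /
          ((u k x : ℂ) + (v k x : ℂ) * I))) := by
      rw [Complex.reCLM_apply, Complex.re_sum]
      refine Finset.sum_congr rfl fun k _ => ?_
      rw [re_c_mul_logDeriv (γ k) (δ k) (deriv (u k) x) (deriv (v k) x) (hslit k x hx)]
    rw [hσx]
    exact h2
  have hσc : ContinuousOn σ (Ioo a b) := by
    refine continuousOn_finsetSum _ fun k _ => ?_
    exact (continuousOn_const.mul (hRLc k)).sub (continuousOn_const.mul (hILc k))
  -- the numerical relation at `ϖ = 1`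
  have hnum : (N 1 - N 0) + (∑ k, ((γ k : ℂ) + (δ k : ℂ) * I) *
      (Complex.log (W k 1) - Complex.log (W k 0))).re = 0 := by
    have hone : (1:ℝ) ∈ Ioc (0:ℝ) 1 := ⟨zero_lt_one, le_rfl⟩
    have hi1 := integrableOn_dilate_one ha hb hN'c ⟨zero_le_one, le_rfl⟩ (F := deriv N)
    have hi2 := integrableOn_dilate_one ha hb hσc ⟨zero_le_one, le_rfl⟩ (F := σ)
    have hsplit := integral_add hi1 hi2
    have hA : (∫ z in Set.pi Set.univ (fun _ : Fin 1 => Icc (0:ℝ) 1), deriv N (((1:ℝ) • z) 0)) =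
        N 1 - N 0 := by
      rw [dilation_integral_deriv ha hb hNa ⟨zero_le_one, le_rfl⟩, dslope_of_ne _ one_ne_zero,
        slope_def_field]
      simp
    have hB : (∫ z in Set.pi Set.univ (fun _ : Fin 1 => Icc (0:ℝ) 1), σ (((1:ℝ) • z) 0)) =
        Λ 1 - Λ 0 := by
      rw [dilation_integral_of_hasDerivAt ha hb hΛd hσc hone, div_one]
    have hΛdiff : Λ 1 - Λ 0 = (∑ k, ((γ k : ℂ) + (δ k : ℂ) * I) *
        (Complex.log (W k 1) - Complex.log (W k 0))).re := by
      simp only [hΛ_def]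
      rw [← Complex.sub_re, ← Finset.sum_sub_distrib]
      congr 1
      exact Finset.sum_congr rfl fun k _ => by ring
    rw [← hΛdiff, ← hA, ← hB, ← hsplit]
    have hfun : (fun z : Fin 1 → ℝ => deriv N (((1:ℝ) • z) 0) + σ (((1:ℝ) • z) 0)) =
        fun z => deriv N (((1:ℝ) • z) 0) + ∑ k,
          (γ k * ((deriv (u k) (((1:ℝ) • z) 0) * u k (((1:ℝ) • z) 0) +
              deriv (v k) (((1:ℝ) • z) 0) * v k (((1:ℝ) • z) 0)) /
              (u k (((1:ℝ) • z) 0) ^ 2 + v k (((1:ℝ) • z) 0) ^ 2)) -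
            δ k * ((deriv (v k) (((1:ℝ) • z) 0) * u k (((1:ℝ) • z) 0) -
              deriv (u k) (((1:ℝ) • z) 0) * v k (((1:ℝ) • z) 0)) /
              (u k (((1:ℝ) • z) 0) ^ 2 + v k (((1:ℝ) • z) 0) ^ 2))) := by
      funext z; simp only [hσ_def, hRL, hIL]
    rw [hfun]
    exact hsum
  -- endpoint values are algebraic and non-zero
  have hu0 : ∀ k, IsAlgebraic ℚ (u k 0) := fun k => (hus k).isAlgebraic_apply_one h0I isAlgebraic_zero
  have hv0 : ∀ k, IsAlgebraic ℚ (v k 0) := fun k => (hvs k).isAlgebraic_apply_one h0I isAlgebraic_zero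
  have hu1 : ∀ k, IsAlgebraic ℚ (u k 1) := fun k => (hus k).isAlgebraic_apply_one h1I isAlgebraic_one
  have hv1 : ∀ k, IsAlgebraic ℚ (v k 1) := fun k => (hvs k).isAlgebraic_apply_one h1I isAlgebraic_one
  have hW0alg : ∀ k, IsAlgebraic ℚ (W k 0) := fun k => isAlgebraic_ofReal_add_ofReal_mul_I (hu0 k) (hv0 k)
  have hW1alg : ∀ k, IsAlgebraic ℚ (W k 1) := fun k => isAlgebraic_ofReal_add_ofReal_mul_I (hu1 k) (hv1 k)
  have hW0ne : ∀ k, W k 0 ≠ 0 := fun k => loop_ne_zero (hslit k 0 h0I)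
  have hW1ne : ∀ k, W k 1 ≠ 0 := fun k => loop_ne_zero (hslit k 1 h1I)
  have hralg : IsAlgebraic ℚ (N 1 - N 0) :=
    (hNs.isAlgebraic_apply_one h1I isAlgebraic_one).sub (hNs.isAlgebraic_apply_one h0I isAlgebraic_zero)
  -- BAKER on the differences of logarithms
  rw [Complex.re_sum] at hnum
  obtain ⟨hr0, aR, aI, e, f, haR, haI, hErel, hFrel, hdecomp⟩ :=
    liouville_decomposition hW0alg hW1alg hW0ne hW1ne hγ hδ hralg hnum
  -- the normalised moduli `M_k = |w_k|²/|w_k(0)|²`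
  set M : Fin A → ℝ → ℝ := fun k x => (u k x ^ 2 + v k x ^ 2) / (u k 0 ^ 2 + v k 0 ^ 2) with hM
  set M' : Fin A → ℝ → ℝ := fun k x =>
    2 * (deriv (u k) x * u k x + deriv (v k) x * v k x) / (u k 0 ^ 2 + v k 0 ^ 2) with hM'
  have hm0pos : ∀ k, 0 < u k 0 ^ 2 + v k 0 ^ 2 := fun k => modSq_pos (hslit k 0 h0I)
  have hm0alg : ∀ k, IsAlgebraic ℚ ((u k 0 ^ 2 + v k 0 ^ 2)⁻¹) := fun k =>
    (((hu0 k).pow 2).add ((hv0 k).pow 2)).inv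
  have hMs : ∀ k, IsSemialgebraicFunOn ℚ {t : Fin 1 → ℝ | t 0 ∈ Ioo a b} (fun t => M k (t 0)) := by
    intro k
    have h := (isSemialgebraicFunOn_modSq (hus k) (hvs k)).fun_mul
      (isSemialgebraicFunOn_const_of_isAlgebraic hI (hm0alg k))
    refine h.congr fun t _ => ?_
    simp only [hM, div_eq_mul_inv]
  have hMa : ∀ k, ∀ x ∈ Ioo a b, AnalyticAt ℝ (M k) x := fun k x hx => by
    simp only [hM]
    exact (analyticAt_modSq (hua k x hx) (hva k x hx)).div analyticAt_const (hm0pos k).ne'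
  have hMpos : ∀ k, ∀ x ∈ Ioo a b, 0 < M k x := fun k x hx =>
    div_pos (modSq_pos (hslit k x hx)) (hm0pos k)
  have hMder : ∀ k, ∀ x ∈ Ioo a b, HasDerivAt (M k) (M' k x) x := by
    intro k x hx
    have h := (hasDerivAt_modSq (hud k x hx) (hvd k x hx)).div_const (u k 0 ^ 2 + v k 0 ^ 2)
    simp only [hM, hM']
    exact h
  have hM0 : ∀ k, M k 0 = 1 := fun k => div_self (hm0pos k).ne'
  have hMrel : ∀ j, ∑ k, (e j k : ℝ) * Real.log (M k 1) = 0 := by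
    intro j
    have hlog : ∀ k, Real.log (M k 1) = 2 * (Real.log ‖W k 1‖ - Real.log ‖W k 0‖) := by
      intro k
      simp only [hM, hW_def]
      rw [Real.log_div (hm0 k 1 h1I) (hm0pos k).ne', log_norm_loop (hslit k 1 h1I),
        log_norm_loop (hslit k 0 h0I)]
      ring
    have : ∑ k, (e j k : ℝ) * Real.log (M k 1) =
        2 * ∑ k, (e j k : ℝ) * (Real.log ‖W k 1‖ - Real.log ‖W k 0‖) := by
      rw [Finset.mul_sum]
      exact Finset.sum_congr rfl fun k _ => by rw [hlog]; ring
    rw [this, hErel j, mul_zero]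
  -- `M'/(2M)` is the real logarithmic derivative
  have hMRL : ∀ k, ∀ x ∈ Ioo a b, M' k x / (2 * M k x) = RL k x := by
    intro k x hx
    simp only [hM, hM', hRL]
    have h1 := hm0 k x hx
    have h2 := (hm0pos k).ne'
    field_simp
  -- the loops as complex functions: Nash data and the argument derivative
  have hWre : ∀ k, IsSemialgebraicFunOn ℚ {t : Fin 1 → ℝ | t 0 ∈ Ioo a b} (fun t => (W k (t 0)).re) :=
    fun k => (hus k).congr fun t _ => by simp [hW_def]
  have hWim : ∀ k, IsSemialgebraicFunOn ℚ {t : Fin 1 → ℝ | t 0 ∈ Ioo a b} (fun t => (W k (t 0)).im) :=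
    fun k => (hvs k).congr fun t _ => by simp [hW_def]
  have hWrea : ∀ k, ∀ x ∈ Ioo a b, AnalyticAt ℝ (fun x => (W k x).re) x := fun k x hx => by
    have : (fun x => (W k x).re) = u k := by funext y; simp [hW_def]
    rw [this]; exact hua k x hx
  have hWima : ∀ k, ∀ x ∈ Ioo a b, AnalyticAt ℝ (fun x => (W k x).im) x := fun k x hx => by
    have : (fun x => (W k x).im) = v k := by funext y; simp [hW_def]
    rw [this]; exact hva k x hx
  have hWslit : ∀ k, ∀ x ∈ Ioo a b, W k x ∈ slitPlane := fun k x hx => loop_mem_slitPlane (hslit k x hx)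
  have hθ : ∀ k, ∀ x ∈ Ioo a b, HasDerivAt (fun y => Complex.arg (W k y)) (IL k x) x := fun k x hx =>
    hasDerivAt_arg_loop (hud k x hx) (hvd k x hx) (hslit k x hx)
  -- the lifts of the modulus and argument parts, for every `j`
  choose KL VL hVLo hVLc hKLs hKLa hLid using fun j =>
    exists_kernel_logPart' ha hb hI hMs hMa hMpos hMder hM0 (e j) (hMrel j)
  choose KA VA hVAo hVAc hKAs hKAa hAid using fun j =>
    exists_kernel_argPart' ha hb hI W hWre hWim hWrea hWima hWslit hθ (f j) (hFrel j)
  -- pointwise decomposition of `σ` along the exact relations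
  have hdecompσ : ∀ x ∈ Ioo a b, σ x =
      ∑ j, (aR j * ∑ k, (e j k : ℝ) * RL k x - aI j * ∑ k, (f j k : ℝ) * IL k x) := by
    intro x hx
    have h := hdecomp fun k => ((((deriv (u k) x : ℝ) : ℂ) + ((deriv (v k) x : ℝ) : ℂ) * I) /
      ((u k x : ℂ) + (v k x : ℂ) * I))
    have hre : ∀ k, (((((deriv (u k) x : ℝ) : ℂ) + ((deriv (v k) x : ℝ) : ℂ) * I) /
        ((u k x : ℂ) + (v k x : ℂ) * I))).re = RL k x := fun k =>
      re_logDeriv (deriv (u k) x) (deriv (v k) x) (hslit k x hx)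
    have him : ∀ k, (((((deriv (u k) x : ℝ) : ℂ) + ((deriv (v k) x : ℝ) : ℂ) * I) /
        ((u k x : ℂ) + (v k x : ℂ) * I))).im = IL k x := fun k =>
      im_logDeriv (deriv (u k) x) (deriv (v k) x) (hslit k x hx)
    have hlhs : σ x = ∑ k, ((((γ k : ℂ) + (δ k : ℂ) * I)) *
        ((((deriv (u k) x : ℝ) : ℂ) + ((deriv (v k) x : ℝ) : ℂ) * I) /
          ((u k x : ℂ) + (v k x : ℂ) * I))).re := by
      simp only [hσ_def]
      refine Finset.sum_congr rfl fun k _ => ?_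
      rw [re_c_mul_logDeriv (γ k) (δ k) (deriv (u k) x) (deriv (v k) x) (hslit k x hx)]
    rw [hlhs, h]
    simp only [hre, him]
  -- the exact part: `v_{N'} = dslope N 0 = (ϖ − 1) τ`
  set τ : ℝ → ℝ := dslope (dslope N 0) 1 with hτ_def
  have hds1 : dslope N 0 1 = 0 := by
    rw [dslope_of_ne _ one_ne_zero, slope_def_field, sub_zero, div_one]; exact hr0
  have hτeq : ∀ ϖ, dslope N 0 ϖ = (ϖ - 1) * τ ϖ := fun ϖ => by
    have h := sub_smul_dslope (dslope N 0) 1 ϖ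
    rw [hds1, sub_zero, smul_eq_mul] at h
    exact h.symm
  have hσ0s : IsSemialgebraicFunOn ℚ {t : Fin 1 → ℝ | t 0 ∈ Ioo a b} (fun t => dslope N 0 (t 0)) := by
    have h := IsSemialgebraicFunOn.dslope_ratCast (f' := deriv N) 0 (by simpa using h0I) hNs hNd
    simpa using h
  have hσ0a : ∀ x ∈ Ioo a b, AnalyticAt ℝ (dslope N 0) x := fun x hx =>
    analyticAt_dslope_of_analyticAt (hNa 0 h0I) (hNa x hx)
  have hτs : IsSemialgebraicFunOn ℚ {t : Fin 1 → ℝ | t 0 ∈ Ioo a b} (fun t => τ (t 0)) := by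
    have h := IsSemialgebraicFunOn.dslope_ratCast (f' := deriv (dslope N 0)) 1 (by simpa using h1I)
      hσ0s (fun x hx => (hσ0a x hx).differentiableAt.hasDerivAt)
    simpa using h
  have hτa : ∀ x ∈ Ioo a b, AnalyticAt ℝ τ x := fun x hx =>
    analyticAt_dslope_of_analyticAt (hσ0a 1 h1I) (hσ0a x hx)
  -- the total kernel
  obtain ⟨Kt, Vt, hVto, hVtc, hKts, hKta, hRHS⟩ := exists_sum_kernel ha hb hI hτs hτa haR haI
    hVLo hVLc hKLs hKLa hVAo hVAc hKAs hKAa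
  refine ⟨Kt, Vt, hVto, hVtc, hKts, hKta, ?_⟩
  -- the identity on `[0,1]`
  · intro ϖ hϖ
    set hL : (Fin A ⊕ Fin A) → ℝ → ℝ := fun j x => ∑ k, (e j k : ℝ) * RL k x with hhL
    set ψ : (Fin A ⊕ Fin A) → ℝ → ℝ := fun j x => ∑ k, (f j k : ℝ) * IL k x with hψ
    have hLc : ∀ j, ContinuousOn (hL j) (Ioo a b) := fun j =>
      continuousOn_finsetSum _ fun k _ => continuousOn_const.mul (hRLc k)
    have hψc : ∀ j, ContinuousOn (ψ j) (Ioo a b) := fun j =>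
      continuousOn_finsetSum _ fun k _ => continuousOn_const.mul (hILc k)
    have hi1 : IntegrableOn (fun z : Fin 1 → ℝ => deriv N ((ϖ • z) 0))
        (Set.pi Set.univ (fun _ : Fin 1 => Icc (0:ℝ) 1)) volume :=
      integrableOn_dilate_one ha hb hN'c hϖ
    have hiL : ∀ j, IntegrableOn (fun z : Fin 1 → ℝ => aR j * hL j ((ϖ • z) 0))
        (Set.pi Set.univ (fun _ : Fin 1 => Icc (0:ℝ) 1)) volume := fun j =>
      (integrableOn_dilate_one ha hb (hLc j) hϖ).const_mul (aR j)
    have hiA : ∀ j, IntegrableOn (fun z : Fin 1 → ℝ => aI j * ψ j ((ϖ • z) 0))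
        (Set.pi Set.univ (fun _ : Fin 1 => Icc (0:ℝ) 1)) volume := fun j =>
      (integrableOn_dilate_one ha hb (hψc j) hϖ).const_mul (aI j)
    have hiLA : ∀ j, IntegrableOn (fun z : Fin 1 → ℝ => aR j * hL j ((ϖ • z) 0) - aI j * ψ j ((ϖ • z) 0))
        (Set.pi Set.univ (fun _ : Fin 1 => Icc (0:ℝ) 1)) volume := fun j => (hiL j).sub (hiA j)
    have hi2 : IntegrableOn (fun z : Fin 1 → ℝ => ∑ j, (aR j * hL j ((ϖ • z) 0) - aI j * ψ j ((ϖ • z) 0)))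
        (Set.pi Set.univ (fun _ : Fin 1 => Icc (0:ℝ) 1)) volume :=
      integrable_finsetSum _ fun j _ => hiLA j
    -- the modulus-part integrand of the lift equals `hL j` on the cube
    have hLid' : ∀ j, (∫ z in Set.pi Set.univ (fun _ : Fin 1 => Icc (0:ℝ) 1), hL j ((ϖ • z) 0)) =
        (ϖ - 1) * ∫ y in Set.pi Set.univ (fun _ : Fin 1 => Icc (0:ℝ) 1),
          KL j (Matrix.vecCons ϖ (ϖ • y)) := by
      intro j
      rw [← hLid j ϖ hϖ]
      refine setIntegral_congr_fun (MeasurableSet.univ_pi fun _ => measurableSet_Icc) fun z hz => ?_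
      have hy := hdil hϖ z hz
      simp only [hhL]
      exact Finset.sum_congr rfl fun k _ => by rw [hMRL k _ hy]
    have hAid' : ∀ j, (∫ z in Set.pi Set.univ (fun _ : Fin 1 => Icc (0:ℝ) 1), ψ j ((ϖ • z) 0)) =
        (ϖ - 1) * ∫ y in Set.pi Set.univ (fun _ : Fin 1 => Icc (0:ℝ) 1),
          KA j (Matrix.vecCons ϖ (ϖ • y)) := by
      intro j
      rw [← hAid j ϖ hϖ]
    -- the logarithmic-derivative integrand equals its decomposition on the cube
    have hσ_split : (∫ z in Set.pi Set.univ (fun _ : Fin 1 => Icc (0:ℝ) 1), σ ((ϖ • z) 0)) =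
        ∫ z in Set.pi Set.univ (fun _ : Fin 1 => Icc (0:ℝ) 1),
          ∑ j, (aR j * hL j ((ϖ • z) 0) - aI j * ψ j ((ϖ • z) 0)) := by
      refine setIntegral_congr_fun (MeasurableSet.univ_pi fun _ => measurableSet_Icc) fun z hz => ?_
      have hy := hdil hϖ z hz
      simp only [hhL, hψ]
      exact hdecompσ _ hy
    -- left-hand side
    have hLHS : (∫ z in Set.pi Set.univ (fun _ : Fin 1 => Icc (0:ℝ) 1),
          (deriv N ((ϖ • z) 0) + ∑ k,
            (γ k * ((deriv (u k) ((ϖ • z) 0) * u k ((ϖ • z) 0) +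
                deriv (v k) ((ϖ • z) 0) * v k ((ϖ • z) 0)) /
                (u k ((ϖ • z) 0) ^ 2 + v k ((ϖ • z) 0) ^ 2)) -
              δ k * ((deriv (v k) ((ϖ • z) 0) * u k ((ϖ • z) 0) -
                deriv (u k) ((ϖ • z) 0) * v k ((ϖ • z) 0)) /
                (u k ((ϖ • z) 0) ^ 2 + v k ((ϖ • z) 0) ^ 2))))) =
        (ϖ - 1) * τ ϖ + ∑ j, (aR j * ((ϖ - 1) *
            ∫ y in Set.pi Set.univ (fun _ : Fin 1 => Icc (0:ℝ) 1), KL j (Matrix.vecCons ϖ (ϖ • y))) -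
          aI j * ((ϖ - 1) *
            ∫ y in Set.pi Set.univ (fun _ : Fin 1 => Icc (0:ℝ) 1), KA j (Matrix.vecCons ϖ (ϖ • y)))) := by
      have hfun : (fun z : Fin 1 → ℝ => deriv N ((ϖ • z) 0) + ∑ k,
            (γ k * ((deriv (u k) ((ϖ • z) 0) * u k ((ϖ • z) 0) +
                deriv (v k) ((ϖ • z) 0) * v k ((ϖ • z) 0)) /
                (u k ((ϖ • z) 0) ^ 2 + v k ((ϖ • z) 0) ^ 2)) -
              δ k * ((deriv (v k) ((ϖ • z) 0) * u k ((ϖ • z) 0) -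
                deriv (u k) ((ϖ • z) 0) * v k ((ϖ • z) 0)) /
                (u k ((ϖ • z) 0) ^ 2 + v k ((ϖ • z) 0) ^ 2)))) =
          fun z => deriv N ((ϖ • z) 0) + σ ((ϖ • z) 0) := by
        funext z; simp only [hσ_def, hRL, hIL]
      have hi2' : IntegrableOn (fun z : Fin 1 → ℝ => σ ((ϖ • z) 0))
          (Set.pi Set.univ (fun _ : Fin 1 => Icc (0:ℝ) 1)) volume :=
        integrableOn_dilate_one ha hb hσc hϖ
      rw [hfun, integral_add hi1 hi2', dilation_integral_deriv ha hb hNa hϖ, hτeq, hσ_split,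
        integral_finsetSum _ fun j _ => hiLA j]
      congr 1
      refine Finset.sum_congr rfl fun j _ => ?_
      rw [integral_sub (hiL j) (hiA j), MeasureTheory.integral_const_mul,
        MeasureTheory.integral_const_mul, hLid' j, hAid' j]
    rw [hLHS, hRHS ϖ hϖ, mul_add, Finset.mul_sum]
    congr 1
    exact Finset.sum_congr rfl fun j _ => by ring

end KZ

end Literature.NumberTheory.Transcendental
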